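import Summits.QuantumFields.YangMills.Theorems.FluctuationComparisonRegPrIntLS2BetaCriticalOrbitUniqueOfExabFree
import Summits.QuantumFields.YangMills.Theorems.FluctuationComparisonRegPrIntLS2BetaPosCollarCoverOfTubeChart
import Summits.QuantumFields.YangMills.Theorems.UnitScaleTiltProp7SymCentreAbelianClose
import Literature.MathematicalPhysics.QuantumFieldTheory.Balaban1983to89.B16Thm1BaseAtRecord11
import HarnessLib

/-!
# S2β · THE ABELIAN CONSTRAINED MINIMISER FROM COMPACTNESS: EX^{ab}′ ⟸ NE^{ab} ∧ REG^{ab}, and Prop. 7 clause 1 at every SMALL datum modulo REG^{ab} ALONE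

Cell `ym3-torus` (YM ladder rung R3 = continuum `SU(2)` Yang–Mills on the three-torus at fixed lattice data — a RUNG: NOT d = 4, NOT infinite volume,
NOT a mass gap, NOT Clay).  Width seat `ym3-torus-px12` (gen 21), pen (B) «ABELIAN STRATUM» FILE 7; crux `stmt-QuantumFields-20520`
(`…Theses.UnitScaleTilt.FluctuationComparisonRegPrIntL`), LINE S2β; `--kind proof --supports stmt-QuantumFields-20520 --as helper`: count-neutral, DEFINITION-FREE
(0 `def`, 0 `instance`, 0 `notation`, 0 `sorry`, default heartbeats).

WHY.  ✓FILE 6 (`…S2BetaCriticalOrbitUniqueOfExabFree`) delivers [Balaban1985Variational] Prop. 7 clause 1 at every `2`-small datum modulo the ONE displayed letter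
EX^{ab}′(V′) = «a σ₃-diagonal member of print's open regular fibre `regFibrePr F n K e V′` minimising the Wilson action among the σ₃-diagonal members».  The configuration
space `SU(2)^{bonds}` is COMPACT and the Wilson action is CONTINUOUS, so a minimiser over the CLOSURE of the diagonal regular fibre always exists; it is σ₃-diagonal (a closed
condition) and — as soon as it is strictly (6)(e)-regular — it lies in the descent fibre (the (0.4) descent is continuous at regular points, ✓`continuousAt_iter_blockAvg_of_plaqSmall`,
and the fibre is closed under such limits, ✓`mem_fibre_of_mem_closure_of_continuousAt`).  So EX^{ab}′ splits into a KINEMATIC part, discharged here, and the two honest letters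
  NE^{ab}(V′)  := «the σ₃-diagonal part of `regFibrePr F n K e V′` is nonempty» — DISCHARGED at every small diagonal datum by ✓`diagonalLift_abelian` (§2), and
  REG^{ab}(V′) := «every minimiser of the Wilson action over the CLOSURE of the σ₃-diagonal part of `regFibrePr F n K e V′` is strictly (6)(e)-regular (`RegPr F n K e`)» —
                 the sup-norm regularity of the constrained abelian minimiser ([Balaban1985Variational] Prop. 7 p.299 ∕ Thm 1 (9)-(10) p.279 for the diagonal torus, with
                 propagator decay).  REG^{ab} is a HYPOTHESIS here, displayed VERBATIM as `hREG`; it is NOT claimed and NOT proved.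

WHAT (`SU(2)`; `F : T3Family`, heights `n ≤ K`, radius `e` with the admissibility rows `143·(49∕4)²·e ≤ 1∕3`, `2e ≤ 2δ₂∕(7L)²`).
* §1 `isClosed_setOf_commute_sigma3`; `continuousAt_descendTo_of_regPr` (the descent `D_{n,K}` is continuous at every `U ∈ 𝔘_K(e)`);
  ★★★`exabFree_of_nonempty_of_regAb (hne : NE^{ab}(V′)) (hREG : REG^{ab}(V′)) : EX^{ab}′(V′)` — compactness + continuity, the kinematic part of EX^{ab}′.
* §2 ★`nonempty_diag_regFibrePr_of_small` — NE^{ab}(V′) at every σ₃-diagonal `V′` with `PlaqSmall ε₁ V′`, `(π∕2)ε₁ ≤ (10⁸L²)⁻¹`, `4·10⁶·(π∕2)ε₁ ≤ e` (✓`diagonalLift_abelian` + monotonicity).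
* §3 ★★★★`atMostOneCriticalOrbit_five_of_regAb` — ✓FILE 6's master door with EX^{ab}′ ↦ NE^{ab} ∧ REG^{ab} at the diagonal case-A representatives;
  ★★★★`atMostOneCriticalOrbit_five_of_regAb_small` — PROP. 7 CLAUSE 1 AT EVERY SMALL DATUM (`PlaqSmall ε₁ V` with the two windows above), `L ≥ 5`, MODULO REG^{ab} ALONE.

HONEST.  Compactness bookkeeping over ✓FILE 5∕6, ✓`diagonalLift_abelian`, ✓`continuousAt_iter_blockAvg_of_plaqSmall`, ✓`mem_fibre_of_mem_closure_of_continuousAt`; REG^{ab} stays a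
HYPOTHESIS (NOT claimed); nothing of Bałaban's analysis asserted; (E), ISOL∘, TUBE-REG∘, GAP♯∘, EXW∘, S2β and crux 20520 NOT proved; rung R3 = `YM3TorusSU2` as filed — SU(2) YM₃
on T³; the Yang–Mills mass gap is NOT proved.  Sorry-free, axioms standard.
[cite: Balaban1985Variational, (2)-(7) p.278, Thm 1 (8)-(10) p.279, Prop. 7 p.299; Balaban1987RG1, (0.4)+(0.11) p.253; Balaban1985Averaging, (8)-(13) p.19, Prop. 2 p.26]
-/

set_option autoImplicit false

noncomputable section

open scoped Matrix.Norms.L2Operator Topology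
open Set Filter
open Literature.MathematicalPhysics.QuantumFieldTheory.Balaban1983to89
open Literature.MathematicalPhysics.QuantumFieldTheory.Balaban1983to89.T4Continuum
open Literature.MathematicalPhysics.QuantumFieldTheory.Balaban1983to89.ExpMeanLog (expMeanLogSU deltaSU)
open Literature.MathematicalPhysics.QuantumFieldTheory.Balaban1983to89.BlockAveraging (blockAvg)
open Literature.MathematicalPhysics.QuantumFieldTheory.Balaban1983to89.B9AdOrthogonal (σ₃)
open Literature.MathematicalPhysics.QuantumFieldTheory.Balaban1983to89.B10Eq27TorusAxialLog (unitsField toUField)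
open Literature.MathematicalPhysics.QuantumFieldTheory.Balaban1983to89.T3ContinuumYM3Torus
open Literature.MathematicalPhysics.QuantumFieldTheory.Balaban1983to89.T3UnitLawDensityEML (ℰp)
open Literature.MathematicalPhysics.QuantumFieldTheory.Balaban1983to89.T3TiltDescent (descendTo)
open Literature.MathematicalPhysics.QuantumFieldTheory.Balaban1983to89.T3ConstrainedMinimiser (fibre)
open Literature.MathematicalPhysics.QuantumFieldTheory.Balaban1983to89.T3PrintedRegularMinimiser
open Literature.MathematicalPhysics.QuantumFieldTheory.Balaban1983to89.T3PrintedMinimiserExistence (regPr_mono)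
open Literature.MathematicalPhysics.QuantumFieldTheory.Balaban1983to89.T3PrintedRegularOrbits (plaqSmall_gaugeAct_iff')
open Literature.MathematicalPhysics.QuantumFieldTheory.Balaban1983to89.T3Thm1Carrier (varProblem3)
open Literature.MathematicalPhysics.QuantumFieldTheory.Balaban1983to89.B16Thm1BaseAtRecord11 (continuous_wilsonAction4_SU)
open Summit.QuantumFields.YangMills.Theorems.MinimiserPin (continuousAt_iter_blockAvg_of_plaqSmall continuous_fieldShift regThreshold_eq)
open Summit.QuantumFields.YangMills.Theorems.Prop7NestedMeanParallelLiftDiagGauge (diagonalLift_abelian)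
open Summit.QuantumFields.YangMills.Theorems.FluctuationComparisonRegPrIntLS2BetaPosCollarCoverOfTubeChart (mem_fibre_of_mem_closure_of_continuousAt)
open Summit.QuantumFields.YangMills.Theorems.FluctuationComparisonRegPrIntLS2BetaCriticalOrbitUniqueOfExabFree (atMostOneCriticalOrbit_five_of_exabFree)

namespace Summit.QuantumFields.YangMills.Theorems.FluctuationComparisonRegPrIntLS2BetaAbelianMinimiserOfRegAb

/-! ## §1 Compactness: EX^{ab}′ ⟸ NE^{ab} ∧ REG^{ab} -/

section Compact

variable (F : T3Family) {n K : ℕ}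

/-- The σ₃-diagonal configurations form a CLOSED subset of `SU(2)^{bonds}`. [folklore] -/
theorem isClosed_setOf_commute_sigma3 (K : ℕ) :
    IsClosed {W : GaugeField (F.P K) 0 (Matrix.specialUnitaryGroup (Fin 2) ℂ) |
      ∀ b, Commute ((W b : Matrix.specialUnitaryGroup (Fin 2) ℂ) : Matrix (Fin 2) (Fin 2) ℂ) σ₃} := by
  have hset : {W : GaugeField (F.P K) 0 (Matrix.specialUnitaryGroup (Fin 2) ℂ) |
      ∀ b, Commute ((W b : Matrix.specialUnitaryGroup (Fin 2) ℂ) : Matrix (Fin 2) (Fin 2) ℂ) σ₃} =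
      ⋂ b : PBond (F.P K) 0, {W | ((W b : Matrix.specialUnitaryGroup (Fin 2) ℂ) : Matrix (Fin 2) (Fin 2) ℂ) * σ₃ =
        σ₃ * ((W b : Matrix.specialUnitaryGroup (Fin 2) ℂ) : Matrix (Fin 2) (Fin 2) ℂ)} := by
    ext W
    simp only [Set.mem_setOf_eq, Set.mem_iInter]
    rfl
  rw [hset]
  refine isClosed_iInter fun b => isClosed_eq ?_ ?_
  · exact (continuous_subtype_val.comp (continuous_apply b)).mul continuous_const
  · exact continuous_const.mul (continuous_subtype_val.comp (continuous_apply b))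

/-- **THE DESCENT `D_{n,K}` IS CONTINUOUS AT EVERY `(6)(e)`-REGULAR CONFIGURATION** (`0 < e` with the admissibility rows): the `(K − n)`-fold (0.4) average is
continuous wherever its guards hold with margin (✓`continuousAt_iter_blockAvg_of_plaqSmall`), and `fieldShift` is continuous.
[cite: Balaban1987RG1, (0.4)+(0.11) p.253; Balaban1985Averaging, Prop. 2 p.26; Balaban1985Variational, (2) p.278] -/
theorem continuousAt_descendTo_of_regPr (h : n ≤ K) {e : ℝ} (he : 0 < e) (hr3 : (143 * ((((3 + 4 : ℕ) : ℝ)) ^ 2 / 4) ^ 2) * e ≤ 1 / 3)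
    (hr2 : 2 * e ≤ 2 * deltaSU (Fin 2) / (((3 + 4) * F.L : ℕ) : ℝ) ^ 2)
    {U : GaugeField (F.P K) 0 (Matrix.specialUnitaryGroup (Fin 2) ℂ)} (hU : RegPr F n K e U) :
    ContinuousAt (descendTo F ℰp n K h) U := by
  have h52 : PlaqSmall (e * ((((F.P K).L : ℝ) ^ (K - n))⁻¹) ^ 2) U := by
    rw [← regThreshold_eq]; exact hU.plaqSmall
  have hiter := continuousAt_iter_blockAvg_of_plaqSmall (N := 2) (P := F.P K) (K - n) he hr3 hr2 h52 (K - n) le_rfl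
  exact (continuous_fieldShift F _).continuousAt.comp hiter

/-- ★★★ **EX^{ab}′ ⟸ NE^{ab} ∧ REG^{ab} — THE ABELIAN CONSTRAINED MINIMISER FROM COMPACTNESS.**  Over any coarse datum `V′`, if the σ₃-diagonal part `S` of print's open
regular fibre `regFibrePr F n K e V′` is NONEMPTY (NE^{ab}) and every minimiser of the Wilson action over `closure S` is strictly `(6)(e)`-regular (REG^{ab}, the hypothesis
`hREG` — NOT claimed), then some σ₃-diagonal `W ∈ regFibrePr F n K e V′` minimises the Wilson action among the σ₃-diagonal members (EX^{ab}′, ✓FILE 6's letter).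
Proof: `SU(2)^{bonds}` is compact, `A` is continuous, so a minimiser `W₀` over the compact `closure S ≠ ∅` exists; `W₀` is diagonal (closed condition), regular (`hREG`),
hence a continuity point of the descent, hence in the fibre (✓`mem_fibre_of_mem_closure_of_continuousAt`); and `S ⊆ closure S`.
[cite: Balaban1985Variational, (2)-(7) p.278, Thm 1 (8)-(10) p.279, Prop. 7 p.299] -/
theorem exabFree_of_nonempty_of_regAb (h : n ≤ K) {e : ℝ} (he : 0 < e) (hr3 : (143 * ((((3 + 4 : ℕ) : ℝ)) ^ 2 / 4) ^ 2) * e ≤ 1 / 3)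
    (hr2 : 2 * e ≤ 2 * deltaSU (Fin 2) / (((3 + 4) * F.L : ℕ) : ℝ) ^ 2)
    {V' : GaugeField (F.P n) 0 (Matrix.specialUnitaryGroup (Fin 2) ℂ)}
    (hne : ∃ W : GaugeField (F.P K) 0 (Matrix.specialUnitaryGroup (Fin 2) ℂ),
      (∀ b, Commute ((W b : Matrix.specialUnitaryGroup (Fin 2) ℂ) : Matrix (Fin 2) (Fin 2) ℂ) σ₃) ∧ W ∈ regFibrePr F n K h e V')
    (hREG : ∀ W₀ ∈ closure {W : GaugeField (F.P K) 0 (Matrix.specialUnitaryGroup (Fin 2) ℂ) |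
        (∀ b, Commute ((W b : Matrix.specialUnitaryGroup (Fin 2) ℂ) : Matrix (Fin 2) (Fin 2) ℂ) σ₃) ∧ W ∈ regFibrePr F n K h e V'},
      IsMinOn wilsonAction4 (closure {W : GaugeField (F.P K) 0 (Matrix.specialUnitaryGroup (Fin 2) ℂ) |
        (∀ b, Commute ((W b : Matrix.specialUnitaryGroup (Fin 2) ℂ) : Matrix (Fin 2) (Fin 2) ℂ) σ₃) ∧ W ∈ regFibrePr F n K h e V'}) W₀ →
      RegPr F n K e W₀) :
    ∃ W : GaugeField (F.P K) 0 (Matrix.specialUnitaryGroup (Fin 2) ℂ),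
      (∀ b, Commute ((W b : Matrix.specialUnitaryGroup (Fin 2) ℂ) : Matrix (Fin 2) (Fin 2) ℂ) σ₃) ∧ W ∈ regFibrePr F n K h e V' ∧
      ∀ W' : GaugeField (F.P K) 0 (Matrix.specialUnitaryGroup (Fin 2) ℂ),
        (∀ b, Commute ((W' b : Matrix.specialUnitaryGroup (Fin 2) ℂ) : Matrix (Fin 2) (Fin 2) ℂ) σ₃) → W' ∈ regFibrePr F n K h e V' →
          wilsonAction4 W ≤ wilsonAction4 W' := by
  haveI : CompactSpace (GaugeField (F.P K) 0 (Matrix.specialUnitaryGroup (Fin 2) ℂ)) :=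
    inferInstanceAs (CompactSpace (PBond (F.P K) 0 → Matrix.specialUnitaryGroup (Fin 2) ℂ))
  set S : Set (GaugeField (F.P K) 0 (Matrix.specialUnitaryGroup (Fin 2) ℂ)) := {W |
    (∀ b, Commute ((W b : Matrix.specialUnitaryGroup (Fin 2) ℂ) : Matrix (Fin 2) (Fin 2) ℂ) σ₃) ∧ W ∈ regFibrePr F n K h e V'} with hS
  have hcpt : IsCompact (closure S) := isClosed_closure.isCompact
  have hne' : (closure S).Nonempty := by
    obtain ⟨W, hW⟩ := hne
    exact ⟨W, subset_closure hW⟩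
  have hcont : ContinuousOn (wilsonAction4 : GaugeField (F.P K) 0 (Matrix.specialUnitaryGroup (Fin 2) ℂ) → ℝ) (closure S) :=
    (continuous_wilsonAction4_SU (N := 2) (F.P K) 0).continuousOn
  obtain ⟨W₀, hW₀, hmin⟩ := hcpt.exists_isMinOn hne' hcont
  have hreg : RegPr F n K e W₀ := hREG W₀ hW₀ hmin
  have hdiag : ∀ b, Commute ((W₀ b : Matrix.specialUnitaryGroup (Fin 2) ℂ) : Matrix (Fin 2) (Fin 2) ℂ) σ₃ :=
    closure_minimal (fun W (hW : W ∈ S) => hW.1) (isClosed_setOf_commute_sigma3 F K) hW₀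
  have hfib : W₀ ∈ fibre F ℰp n K h V' :=
    mem_fibre_of_mem_closure_of_continuousAt F h (closure_mono (fun W (hW : W ∈ S) => ((mem_regFibrePr_iff F).1 hW.2).1) hW₀)
      (continuousAt_descendTo_of_regPr F h he hr3 hr2 hreg)
  exact ⟨W₀, hdiag, (mem_regFibrePr_iff F).2 ⟨hfib, hreg⟩, fun W' hW' hW'reg => (isMinOn_iff.1 hmin) W' (subset_closure ⟨hW', hW'reg⟩)⟩

end Compact

/-! ## §2 NE^{ab} at every small diagonal datum -/

section Nonempty

variable (F : T3Family) {n K : ℕ}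

/-- ★ **NE^{ab} AT A SMALL DIAGONAL DATUM**: over every σ₃-diagonal `V′` with `PlaqSmall ε₁ V′`, `(π∕2)ε₁ ≤ (10⁸L²)⁻¹`, the σ₃-diagonal part of `regFibrePr F n K e V′` is nonempty
for every `e ≥ 4·10⁶·(π∕2)ε₁` — ✓`diagonalLift_abelian` (an abelian regular lift of the diagonal datum, flux sector by flux sector) + ✓`regPr_mono`.
[cite: Balaban1985Variational, (2)-(7) p.278, (13)-(14) p.280; Balaban1985Averaging, (19)-(24) p.21] -/
theorem nonempty_diag_regFibrePr_of_small (h : n ≤ K) {ε₁ e : ℝ} (hε₁ : 0 < ε₁) (hε : Real.pi / 2 * ε₁ ≤ ((10 : ℝ) ^ 8 * (F.L : ℝ) ^ 2)⁻¹)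
    (hεe : 4000000 * (Real.pi / 2 * ε₁) ≤ e) (V' : GaugeField (F.P n) 0 (Matrix.specialUnitaryGroup (Fin 2) ℂ))
    (hdiag : ∀ e' : PBond (F.P n) 0, Commute ((V' e' : Matrix.specialUnitaryGroup (Fin 2) ℂ) : Matrix (Fin 2) (Fin 2) ℂ) σ₃) (hV' : PlaqSmall ε₁ V') :
    ∃ W : GaugeField (F.P K) 0 (Matrix.specialUnitaryGroup (Fin 2) ℂ),
      (∀ b, Commute ((W b : Matrix.specialUnitaryGroup (Fin 2) ℂ) : Matrix (Fin 2) (Fin 2) ℂ) σ₃) ∧ W ∈ regFibrePr F n K h e V' := by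
  obtain ⟨U₁, hfib, hreg, hd⟩ := diagonalLift_abelian F h hε₁ hε V' hdiag hV'
  exact ⟨U₁, hd, (mem_regFibrePr_iff F).2 ⟨hfib, regPr_mono F hεe hreg⟩⟩

end Nonempty

/-! ## §3 The master doors: Prop. 7 clause 1 at every datum modulo NE^{ab} ∧ REG^{ab}; at every SMALL datum modulo REG^{ab} alone -/

section Master

/-- ★★★★ **[Balaban1985Variational] PROP. 7 CLAUSE 1 AT EVERY `2`-SMALL DATUM, `L ≥ 5`, MODULO NE^{ab} ∧ REG^{ab}** — ✓FILE 6 `atMostOneCriticalOrbit_five_of_exabFree` with its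
letter EX^{ab}′ supplied by §1 from NE^{ab}(g • V) and REG^{ab}(g • V) at the σ₃-diagonal case-A representatives `g • V` (REG^{ab} NOT claimed).
[cite: Balaban1985Variational, Prop. 7 p.299, (2)-(7) p.278, Thm 1 (8)-(10) p.279; Balaban1985BackgroundPropagators, (3.21) p.394; Balaban1985Averaging, (8)-(13) p.19] -/
theorem atMostOneCriticalOrbit_five_of_regAb (L : ℕ) (h5 : 5 ≤ L) :
    ∃ e₉ : ℝ, 0 < e₉ ∧ ∀ (F : T3Family), F.L = L → ∀ (n K : ℕ) (hnK : n < K) (e : ℝ) (V : GaugeField (F.P n) 0 (Matrix.specialUnitaryGroup (Fin 2) ℂ)) (δ : ℝ),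
      0 < e → e ≤ e₉ → (143 * ((((3 + 4 : ℕ) : ℝ)) ^ 2 / 4) ^ 2) * e ≤ 1 / 3 → 2 * e ≤ 2 * deltaSU (Fin 2) / (((3 + 4) * F.L : ℕ) : ℝ) ^ 2 →
      δ ≤ 2 → PlaqSmall δ V →
      (∀ g : GaugeTransf (F.P n) 0 (Matrix.specialUnitaryGroup (Fin 2) ℂ),
        (∀ e' : PBond (F.P n) 0, Commute ((GaugeField.gaugeAct g V e' : Matrix.specialUnitaryGroup (Fin 2) ℂ) : Matrix (Fin 2) (Fin 2) ℂ) σ₃) →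
        (∀ c : Site (F.P n) 0 → Matrix (Fin 2) (Fin 2) ℂ,
          (∀ e' : PBond (F.P n) 0, c e'.src = ((unitsField (toUField (GaugeField.gaugeAct g V)) e' : (Matrix (Fin 2) (Fin 2) ℂ)ˣ) : Matrix (Fin 2) (Fin 2) ℂ) * c e'.tgt *
            (((unitsField (toUField (GaugeField.gaugeAct g V)) e')⁻¹ : (Matrix (Fin 2) (Fin 2) ℂ)ˣ) : Matrix (Fin 2) (Fin 2) ℂ)) →
          ∃ c₀ : Matrix (Fin 2) (Fin 2) ℂ, (∀ y, c y = c₀) ∧ Commute c₀ σ₃) →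
        (∃ W : GaugeField (F.P K) 0 (Matrix.specialUnitaryGroup (Fin 2) ℂ),
          (∀ b, Commute ((W b : Matrix.specialUnitaryGroup (Fin 2) ℂ) : Matrix (Fin 2) (Fin 2) ℂ) σ₃) ∧ W ∈ regFibrePr F n K hnK.le e (GaugeField.gaugeAct g V)) ∧
        (∀ W₀ ∈ closure {W : GaugeField (F.P K) 0 (Matrix.specialUnitaryGroup (Fin 2) ℂ) |
            (∀ b, Commute ((W b : Matrix.specialUnitaryGroup (Fin 2) ℂ) : Matrix (Fin 2) (Fin 2) ℂ) σ₃) ∧ W ∈ regFibrePr F n K hnK.le e (GaugeField.gaugeAct g V)},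
          IsMinOn wilsonAction4 (closure {W : GaugeField (F.P K) 0 (Matrix.specialUnitaryGroup (Fin 2) ℂ) |
            (∀ b, Commute ((W b : Matrix.specialUnitaryGroup (Fin 2) ℂ) : Matrix (Fin 2) (Fin 2) ℂ) σ₃) ∧ W ∈ regFibrePr F n K hnK.le e (GaugeField.gaugeAct g V)}) W₀ →
          RegPr F n K e W₀)) →
      (varProblem3 F n K hnK.le).AtMostOneCriticalOrbit e V := by
  obtain ⟨e₉, he₉, H⟩ := atMostOneCriticalOrbit_five_of_exabFree L h5
  refine ⟨e₉, he₉, fun F hF n K hnK e V δ he hee hr3 hr2 hδ hV hNR => H F hF n K hnK e V δ he hee hr3 hr2 hδ hV fun g hdiag hA => ?_⟩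
  obtain ⟨hne, hREG⟩ := hNR g hdiag hA
  exact exabFree_of_nonempty_of_regAb F hnK.le he hr3 hr2 hne hREG

/-- ★★★★ **[Balaban1985Variational] PROP. 7 CLAUSE 1 AT EVERY SMALL DATUM, `L ≥ 5`, MODULO REG^{ab} ALONE.**  There is `e₉ > 0` such that for every member `F` (`F.L = L`),
heights `n < K`, every `0 < e ≤ e₉` with the admissibility rows, and every datum `V` with `PlaqSmall ε₁ V`, `0 < ε₁`, `(π∕2)ε₁ ≤ (10⁸L²)⁻¹`, `4·10⁶·(π∕2)ε₁ ≤ e`: IF, at every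
σ₃-diagonal case-A representative `g • V`, every minimiser of the Wilson action over the closure of the σ₃-diagonal part of `regFibrePr F n K e (g • V)` is strictly
`(6)(e)`-regular (REG^{ab} — the ONLY letter, NOT claimed), THEN any two R2-critical configurations of (6)(e) over `V` lie on one orbit of print's group (4):
`(varProblem3 F n K hnK.le).AtMostOneCriticalOrbit e V`.  NE^{ab} is discharged by §2 (the representative is again `ε₁`-small, ✓`plaqSmall_gaugeAct_iff'`).
[cite: Balaban1985Variational, Prop. 7 p.299, (2)-(7) p.278, Thm 1 (8)-(10) p.279, (13)-(14) p.280; Balaban1985BackgroundPropagators, (3.21) p.394; Balaban1985Averaging, (8)-(13) p.19, (19)-(24) p.21] -/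
theorem atMostOneCriticalOrbit_five_of_regAb_small (L : ℕ) (h5 : 5 ≤ L) :
    ∃ e₉ : ℝ, 0 < e₉ ∧ ∀ (F : T3Family), F.L = L → ∀ (n K : ℕ) (hnK : n < K) (e : ℝ) (V : GaugeField (F.P n) 0 (Matrix.specialUnitaryGroup (Fin 2) ℂ)) (ε₁ : ℝ),
      0 < e → e ≤ e₉ → (143 * ((((3 + 4 : ℕ) : ℝ)) ^ 2 / 4) ^ 2) * e ≤ 1 / 3 → 2 * e ≤ 2 * deltaSU (Fin 2) / (((3 + 4) * F.L : ℕ) : ℝ) ^ 2 →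
      0 < ε₁ → Real.pi / 2 * ε₁ ≤ ((10 : ℝ) ^ 8 * (F.L : ℝ) ^ 2)⁻¹ → 4000000 * (Real.pi / 2 * ε₁) ≤ e → PlaqSmall ε₁ V →
      (∀ g : GaugeTransf (F.P n) 0 (Matrix.specialUnitaryGroup (Fin 2) ℂ),
        (∀ e' : PBond (F.P n) 0, Commute ((GaugeField.gaugeAct g V e' : Matrix.specialUnitaryGroup (Fin 2) ℂ) : Matrix (Fin 2) (Fin 2) ℂ) σ₃) →
        (∀ c : Site (F.P n) 0 → Matrix (Fin 2) (Fin 2) ℂ,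
          (∀ e' : PBond (F.P n) 0, c e'.src = ((unitsField (toUField (GaugeField.gaugeAct g V)) e' : (Matrix (Fin 2) (Fin 2) ℂ)ˣ) : Matrix (Fin 2) (Fin 2) ℂ) * c e'.tgt *
            (((unitsField (toUField (GaugeField.gaugeAct g V)) e')⁻¹ : (Matrix (Fin 2) (Fin 2) ℂ)ˣ) : Matrix (Fin 2) (Fin 2) ℂ)) →
          ∃ c₀ : Matrix (Fin 2) (Fin 2) ℂ, (∀ y, c y = c₀) ∧ Commute c₀ σ₃) →
        ∀ W₀ ∈ closure {W : GaugeField (F.P K) 0 (Matrix.specialUnitaryGroup (Fin 2) ℂ) |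
            (∀ b, Commute ((W b : Matrix.specialUnitaryGroup (Fin 2) ℂ) : Matrix (Fin 2) (Fin 2) ℂ) σ₃) ∧ W ∈ regFibrePr F n K hnK.le e (GaugeField.gaugeAct g V)},
          IsMinOn wilsonAction4 (closure {W : GaugeField (F.P K) 0 (Matrix.specialUnitaryGroup (Fin 2) ℂ) |
            (∀ b, Commute ((W b : Matrix.specialUnitaryGroup (Fin 2) ℂ) : Matrix (Fin 2) (Fin 2) ℂ) σ₃) ∧ W ∈ regFibrePr F n K hnK.le e (GaugeField.gaugeAct g V)}) W₀ →
          RegPr F n K e W₀) →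
      (varProblem3 F n K hnK.le).AtMostOneCriticalOrbit e V := by
  obtain ⟨e₉, he₉, H⟩ := atMostOneCriticalOrbit_five_of_regAb L h5
  refine ⟨e₉, he₉, fun F hF n K hnK e V ε₁ he hee hr3 hr2 hε₁ hε hεe hV hREG => ?_⟩
  -- the smallness window forces `ε₁ ≤ 2`
  have hL1 : (1 : ℝ) ≤ (10 : ℝ) ^ 8 * (F.L : ℝ) ^ 2 := by
    have hL : (1 : ℝ) ≤ (F.L : ℝ) := by have := F.hL.2; exact_mod_cast (by omega : 1 ≤ F.L)
    nlinarith
  have hinv : ((10 : ℝ) ^ 8 * (F.L : ℝ) ^ 2)⁻¹ ≤ 1 := inv_le_one_of_one_le₀ hL1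
  have hε2 : ε₁ ≤ 2 := by nlinarith [Real.pi_gt_three, hε.trans hinv]
  refine H F hF n K hnK e V ε₁ he hee hr3 hr2 hε2 hV fun g hdiag hA => ⟨?_, hREG g hdiag hA⟩
  exact nonempty_diag_regFibrePr_of_small F hnK.le hε₁ hε hεe (GaugeField.gaugeAct g V) hdiag ((plaqSmall_gaugeAct_iff' ε₁ g V).mpr hV)

end Master

end Summit.QuantumFields.YangMills.Theorems.FluctuationComparisonRegPrIntLS2BetaAbelianMinimiserOfRegAb

end
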